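import Summits.Ventures.LatticeQCDFlow.Scoring.InfiniteVolumeLimit2D
import HarnessLib

/-!
# The exact non-abelian area law in two dimensions, V-p: THE INFINITE-VOLUME STATE IS ULTRALOCAL — plaquettes at distinct sites are independent, each with the one-plaquette tilted Haar law

HONEST FRAMING: exact (Metropolis-corrected) sampling algorithms for lattice gauge theory;
figures of merit are autocorrelation/cost numbers at stated couplings and volumes; no
continuum-physics claim.

Venture `LatticeQCDFlow` (cell pub-lqcd), sub-topic `Scoring`; FANOUT row 5 (`s0-sun-a`), GEN-19.
NEW WORK of the cell (placement rule).  Every compact metrisable gauge group `G`, continuous representation `ρ`,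
EVERY real `β`; the infinite-volume limit point(s) `μ` of the two-dimensional torus Wilson states (unique, V-k);
`w = e^{−β(N − Re tr ρ)}`, `m = ∫ w dHaar`.

* §1 **`integral_prod_plaquette_comp_eq`** — on the torus `(ℤ/L)²` under product Haar measure, for sites
  `φ(q)`, `q ∈ s`, pairwise distinct and all different from a puncture `x₀`, and continuous `K_q : G → ℝ`:
  `∫ ∏_{q∈s} K_q(U_{φ(q)}) dHaar^{⊗E} = ∏_{q∈s} ∫ K_q dHaar` (row 30's law form `map_plaquettes_eq_pi` — off a
  puncture the plaquettes are i.i.d. Haar — plus `measurePreserving_comp_of_injective` and Fubini);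
* §2 **`integral_prod_plaquetteObs_eq_of_mem_two`** — ULTRALOCALITY: for every finite set `Z ⊂ ℤ²` of sites and
  continuous `f_z : G → ℝ`,  `∫ ∏_{z∈Z} f_z(U_z) dμ = ∏_{z∈Z} (∫ f_z w dHaar / m)`: under the infinite-volume state the
  plaquette variables at distinct sites are INDEPENDENT, each distributed by the one-plaquette tilted Haar law
  `w dHaar / m`; **`integral_plaquetteObs_eq_of_mem_two`** (one plaquette: `⟨f(U_z)⟩_μ = ∫ f w / m`) and
  **`integral_mul_plaquetteObs_eq_of_mem_two`** (two distinct plaquettes: `⟨f(U_z) g(U_{z'})⟩_μ = ⟨f(U_z)⟩_μ ⟨g(U_{z'})⟩_μ`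
  — ALL CONNECTED CORRELATIONS OF PLAQUETTE OBSERVABLES VANISH IDENTICALLY: zero correlation length).

Published form: Gross–Witten 1980 §II / Migdal 1975 (in an axial gauge on the plane the plaquette variables are
independent).  Here on the torus limit, without gauge fixing.  No `def`, nothing cited as a fact, 0 sorry.
-/

noncomputable section

open MeasureTheory Function Finset Filter Topology
open Literature.MathematicalPhysics.QuantumFieldTheory
open Literature.MathematicalPhysics.QuantumLattice
open Summit.Ventures.LatticeQCDFlow.Theory2.Lattice
open Summit.Ventures.LatticeQCDFlow.Theory2.Lattice.TwoDim

namespace Summit.Ventures.LatticeQCDFlow.Scoring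


/-! ## §1. Torus: distinct plaquettes off a puncture are independent Haar (Bochner form) -/

section Torus

variable {L : ℕ} [NeZero L] {G : Type*} [Group G] [TopologicalSpace G] [IsTopologicalGroup G]
  [CompactSpace G] [SecondCountableTopology G] [MeasurableSpace G] [BorelSpace G]

/-- **Distinct plaquettes off a puncture are independent and Haar distributed** (real Bochner form of row 30's
`map_plaquettes_eq_pi`): for `φ` injective on `s` with `φ(q) ≠ x₀` and continuous `K_q`,
`∫ ∏_{q∈s} K_q(U_{φ(q)}) dHaar^{⊗E} = ∏_{q∈s} ∫ K_q dHaar` (`L ≥ 2`). -/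
theorem integral_prod_plaquette_comp_eq (hL : 2 ≤ L) (x₀ : Site 2 L) {ι : Type*} (s : Finset ι)
    (φ : ι → Site 2 L) (hφ : Set.InjOn φ ↑s) (hx₀ : ∀ q ∈ s, φ q ≠ x₀) (K : ι → G → ℝ)
    (hK : ∀ q, Continuous (K q)) :
    ∫ U, ∏ q ∈ s, K q (plaquetteHolonomy U (φ q) 0 1) ∂(Measure.pi fun _ : Edge 2 L => haarProbability G) =
      ∏ q ∈ s, ∫ g, K q g ∂(haarProbability G) := by
  classical
  -- the plaquette map to `G^{x ≠ x₀}` and the coordinates `q ↦ φ q`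
  set π : GaugeConfig 2 L G → ({x : Site 2 L // x ≠ x₀} → G) :=
    fun U x => plaquetteHolonomy U x.1 0 1 with hπ_def
  have hπ : Measurable π :=
    measurable_pi_lambda _ fun x => (continuous_config_plaquetteHolonomy x.1 0 1).measurable
  set c : ↥s → {x : Site 2 L // x ≠ x₀} := fun q => ⟨φ q, hx₀ q q.2⟩ with hc_def
  have hc : Injective c := fun q q' h => Subtype.ext (hφ q.2 q'.2 (congrArg Subtype.val h))
  set Ψ : (↥s → G) → ℝ := fun v => ∏ q : ↥s, K q (v q) with hΨ_def
  have hΨ : Continuous Ψ := continuous_finsetProd _ fun q _ => (hK q).comp (continuous_apply q)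
  have hΨc : Continuous fun u : {x : Site 2 L // x ≠ x₀} → G => Ψ (fun q => u (c q)) :=
    hΨ.comp (continuous_pi fun q => continuous_apply _)
  have h1 : ∀ U : GaugeConfig 2 L G, ∏ q ∈ s, K q (plaquetteHolonomy U (φ q) 0 1) =
      Ψ (fun q => (π U) (c q)) := fun U => by
    rw [hΨ_def, ← Finset.prod_coe_sort s]
  simp_rw [h1]
  have hmp := measurePreserving_comp_of_injective (haarProbability G) hc
  calc ∫ U, Ψ (fun q => (π U) (c q)) ∂(Measure.pi fun _ : Edge 2 L => haarProbability G)
      = ∫ u, Ψ (fun q => u (c q)) ∂((Measure.pi fun _ : Edge 2 L => haarProbability G).map π) := by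
        rw [integral_map hπ.aemeasurable hΨc.aestronglyMeasurable]
    _ = ∫ u, Ψ (fun q => u (c q)) ∂(Measure.pi fun _ : {x : Site 2 L // x ≠ x₀} => haarProbability G) := by
        rw [hπ_def, map_plaquettes_eq_pi hL x₀]
    _ = ∫ v, Ψ v ∂(Measure.pi fun _ : ↥s => haarProbability G) := by
        rw [← hmp.map_eq, integral_map hmp.measurable.aemeasurable hΨ.aestronglyMeasurable]
    _ = ∏ q : ↥s, ∫ g, K q g ∂(haarProbability G) := integral_fintype_prod_eq_prod _
    _ = ∏ q ∈ s, ∫ g, K q g ∂(haarProbability G) :=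
        Finset.prod_coe_sort s (fun q => ∫ g, K q g ∂(haarProbability G))

end Torus

/-! ## §2. Ultralocality of the infinite-volume state -/

section InfiniteVolume

variable {G : Type*} [Group G] [TopologicalSpace G] [IsTopologicalGroup G]
  [CompactSpace G] [T2Space G] [SecondCountableTopology G] [MeasurableSpace G] [BorelSpace G] {N : ℕ}
  (ρ : G →* Matrix (Fin N) (Fin N) ℂ)

omit [TopologicalSpace G] [IsTopologicalGroup G] [CompactSpace G] [T2Space G] [SecondCountableTopology G]
  [MeasurableSpace G] [BorelSpace G] in
/-- A product of plaquette observables is a cylinder observable supported on the links of its plaquettes. -/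
theorem isCylinder_prod_plaquetteObs (Z : Finset (Literature.Probability.LatticeModels.Site 2)) (f : (Literature.Probability.LatticeModels.Site 2) → G → ℝ) :
    IsCylinder (fun V : LGConfig 2 G => ∏ z ∈ Z, f z (plaquetteHolonomyZd V z 0 1))
      (Z.biUnion fun z => ({(z, 0), (z + Pi.single 0 1, 1), (z + Pi.single 1 1, 0), (z, 1)} : Finset ((Literature.MathematicalPhysics.QuantumLattice.ZdEdge 2)))) := by
  intro V V' hVV'
  refine Finset.prod_congr rfl fun z hz => ?_
  have h : ∀ e ∈ ({(z, 0), (z + Pi.single 0 1, 1), (z + Pi.single 1 1, 0), (z, 1)} : Finset ((Literature.MathematicalPhysics.QuantumLattice.ZdEdge 2))), V e = V' e :=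
    fun e he => hVV' e (Finset.mem_coe.2 (Finset.mem_biUnion.2 ⟨z, hz, he⟩))
  simp only [plaquetteHolonomyZd]
  rw [h _ (by simp), h (z + Pi.single 0 1, 1) (by simp), h (z + Pi.single 1 1, 0) (by simp), h (z, 1) (by simp)]

/-- **ULTRALOCALITY OF THE INFINITE-VOLUME TWO-DIMENSIONAL LATTICE GAUGE THEORY.**  For every compact metrisable
`G`, continuous `ρ`, real `β`, every infinite-volume limit point `μ`, every finite set `Z` of sites of `ℤ²` and
continuous `f_z : G → ℝ`:  `∫ ∏_{z∈Z} f_z(U_z) dμ = ∏_{z∈Z} (∫ f_z w dHaar / ∫ w dHaar)`, `w = e^{−β(N − Re tr ρ)}` — the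
plaquette variables at distinct sites are independent under `μ`, each with the one-plaquette tilted Haar law. -/
theorem integral_prod_plaquetteObs_eq_of_mem_two (hρ : Continuous ρ) {β : ℝ} {μ : Measure (LGConfig 2 G)}
    (hμ : μ ∈ infiniteVolumeLimitPoints ρ β) (Z : Finset (Literature.Probability.LatticeModels.Site 2)) (f : (Literature.Probability.LatticeModels.Site 2) → G → ℝ)
    (hf : ∀ z, Continuous (f z)) :
    ∫ V, ∏ z ∈ Z, f z (plaquetteHolonomyZd V z 0 1) ∂μ =
      ∏ z ∈ Z, ((∫ g, f z g * Real.exp (-(β * ((N : ℝ) - (ρ g).trace.re))) ∂(haarProbability G)) /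
        ∫ g, Real.exp (-(β * ((N : ℝ) - (ρ g).trace.re))) ∂(haarProbability G)) := by
  classical
  -- the weight
  have htr : Continuous fun g : G => (ρ g).trace.re := Complex.continuous_re.comp hρ.matrix_trace
  have hw : Continuous fun g : G => Real.exp (-(β * ((N : ℝ) - (ρ g).trace.re))) := by
    have := htr
    fun_prop
  have hm_pos : 0 < ∫ g, Real.exp (-(β * ((N : ℝ) - (ρ g).trace.re))) ∂(haarProbability G) :=
    integral_exp_pos (integrable_haarProbability_of_continuous hw)
  -- the observable: cylinder, continuous, bounded
  set F : LGConfig 2 G → ℝ := fun V => ∏ z ∈ Z, f z (plaquetteHolonomyZd V z 0 1) with hF_def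
  set S : Finset ((Literature.MathematicalPhysics.QuantumLattice.ZdEdge 2)) :=
    Z.biUnion fun z => ({(z, 0), (z + Pi.single 0 1, 1), (z + Pi.single 1 1, 0), (z, 1)} : Finset ((Literature.MathematicalPhysics.QuantumLattice.ZdEdge 2))) with hS_def
  have hFS : IsCylinder F S := isCylinder_prod_plaquetteObs Z f
  have hholc : ∀ z : (Literature.Probability.LatticeModels.Site 2), Continuous fun V : LGConfig 2 G => plaquetteHolonomyZd V z 0 1 := by
    intro z
    unfold plaquetteHolonomyZd
    fun_prop
  have hFc : Continuous F := continuous_finsetProd _ fun z _ => (hf z).comp (hholc z)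
  obtain ⟨Cz, hCz⟩ : ∃ C : (Literature.Probability.LatticeModels.Site 2) → ℝ, ∀ z g, |f z g| ≤ C z := by
    have h : ∀ z, ∃ C, ∀ g, |f z g| ≤ C := fun z => by
      obtain ⟨C, hC⟩ := isCompact_univ.exists_bound_of_continuousOn (hf z).continuousOn
      exact ⟨C, fun g => by simpa [Real.norm_eq_abs] using hC g (Set.mem_univ g)⟩
    exact ⟨fun z => (h z).choose, fun z => (h z).choose_spec⟩
  have hFb : ∀ V, |F V| ≤ ∏ z ∈ Z, |Cz z| := fun V => by
    rw [hF_def, Finset.abs_prod]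
    exact Finset.prod_le_prod (fun z _ => abs_nonneg _) fun z _ => (hCz z _).trans (le_abs_self _)
  -- a box containing the plaquettes and their links
  set M : ℕ := (Z.sup fun z => Finset.univ.sup fun i : Fin 2 => (z i).natAbs) + 1 with hM
  have hMle : ∀ z ∈ Z, ∀ i, |z i| + 1 ≤ (M : ℤ) := fun z hz i => by
    have h1 : (z i).natAbs ≤ Z.sup fun z => Finset.univ.sup fun i : Fin 2 => (z i).natAbs :=
      (Finset.le_sup (f := fun i : Fin 2 => (z i).natAbs) (Finset.mem_univ i)).trans
        (Finset.le_sup (f := fun z : (Literature.Probability.LatticeModels.Site 2) => Finset.univ.sup fun i : Fin 2 => (z i).natAbs) hz)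
    have h2 : (z i).natAbs + 1 ≤ M := by rw [hM]; omega
    have h3 : (((z i).natAbs : ℕ) : ℤ) + 1 ≤ (M : ℤ) := by exact_mod_cast h2
    rwa [Int.natCast_natAbs] at h3
  set Box : Finset (Literature.Probability.LatticeModels.Site 2) := (range (2 * M + 1) ×ˢ range (2 * M + 1)).image
    (fun q : ℕ × ℕ => (![-(M : ℤ) + q.1, -(M : ℤ) + q.2] : (Literature.Probability.LatticeModels.Site 2))) with hBox
  have hmemBox : ∀ y : (Literature.Probability.LatticeModels.Site 2), |y 0| ≤ M → |y 1| ≤ M → y ∈ Box := fun y h0 h1 => by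
    have h0' := abs_le.1 h0
    have h1' := abs_le.1 h1
    refine Finset.mem_image.2 ⟨((y 0 + M).toNat, (y 1 + M).toNat),
      Finset.mem_product.2 ⟨Finset.mem_range.2 (by omega), Finset.mem_range.2 (by omega)⟩, ?_⟩
    funext k
    have h01 : ∀ k : Fin 2, k = 0 ∨ k = 1 := by decide
    rcases h01 k with rfl | rfl
    · simp only [Matrix.cons_val_zero]
      omega
    · simp only [Matrix.cons_val_one, Matrix.cons_val_fin_one]
      omega
  have hZBox : ∀ z ∈ Z, z ∈ Box := fun z hz =>
    hmemBox z (by linarith [hMle z hz 0, abs_nonneg (z 0)]) (by linarith [hMle z hz 1, abs_nonneg (z 1)])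
  have hS : ∀ e ∈ S, e.1 ∈ Box := by
    intro e he
    obtain ⟨z, hz, he'⟩ := Finset.mem_biUnion.1 he
    have hz0 := hMle z hz 0
    have hz1 := hMle z hz 1
    have ha0 := abs_le.1 (show |z 0| ≤ (M : ℤ) - 1 by linarith)
    have ha1 := abs_le.1 (show |z 1| ≤ (M : ℤ) - 1 by linarith)
    simp only [Finset.mem_insert, Finset.mem_singleton] at he'
    rcases he' with rfl | rfl | rfl | rfl
    · exact hZBox z hz
    · refine hmemBox _ ?_ ?_ <;> simp [Pi.add_apply, abs_le] <;> constructor <;> omega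
    · refine hmemBox _ ?_ ?_ <;> simp [Pi.add_apply, abs_le] <;> constructor <;> omega
    · exact hZBox z hz
  set E' : Finset ((Literature.MathematicalPhysics.QuantumLattice.ZdEdge 2)) :=
    (Box ∪ Box.image (· + Pi.single 0 1) ∪ Box.image (· + Pi.single 1 1)) ×ˢ Finset.univ with hE'
  have hSE : S ⊆ E' := fun e he =>
    Finset.mem_product.2 ⟨Finset.mem_union_left _ (Finset.mem_union_left _ (hS e he)), Finset.mem_univ _⟩
  have hE : ∀ z ∈ Box, ((z, 0) : (Literature.MathematicalPhysics.QuantumLattice.ZdEdge 2)) ∈ E' ∧ ((z + Pi.single 0 1, 1) : (Literature.MathematicalPhysics.QuantumLattice.ZdEdge 2)) ∈ E' ∧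
      ((z + Pi.single 1 1, 0) : (Literature.MathematicalPhysics.QuantumLattice.ZdEdge 2)) ∈ E' ∧ ((z, 1) : (Literature.MathematicalPhysics.QuantumLattice.ZdEdge 2)) ∈ E' := fun z hz =>
    ⟨Finset.mem_product.2 ⟨Finset.mem_union_left _ (Finset.mem_union_left _ hz), Finset.mem_univ _⟩,
      Finset.mem_product.2 ⟨Finset.mem_union_left _ (Finset.mem_union_right _
        (Finset.mem_image_of_mem _ hz)), Finset.mem_univ _⟩,
      Finset.mem_product.2 ⟨Finset.mem_union_right _ (Finset.mem_image_of_mem _ hz), Finset.mem_univ _⟩,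
      Finset.mem_product.2 ⟨Finset.mem_union_left _ (Finset.mem_union_left _ hz), Finset.mem_univ _⟩⟩
  -- the free-boundary identification (V-k)
  rw [show (∫ V, ∏ z ∈ Z, f z (plaquetteHolonomyZd V z 0 1) ∂μ) = ∫ V, F V ∂μ from rfl,
    integral_eq_freeBoundary_of_mem_two ρ hρ hμ hFS hFc hFb hSE hS hE]
  -- continuity of the two fixed integrands on `G^{E'}`
  have hpad : Continuous (padConfig (G := G) E') := continuous_padConfig E'
  have hholp : ∀ z : (Literature.Probability.LatticeModels.Site 2), Continuous fun u : ↥E' → G => plaquetteHolonomyZd (padConfig E' u) z 0 1 :=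
    fun z => (hholc z).comp hpad
  have hg1 : Continuous fun u : ↥E' → G => ∏ z ∈ Box,
      Real.exp (-(β * ((N : ℝ) - (ρ (plaquetteHolonomyZd (padConfig E' u) z 0 1)).trace.re))) :=
    continuous_finsetProd _ fun z _ => hw.comp (hholp z)
  have hgF : Continuous fun u : ↥E' → G => F (padConfig E' u) * ∏ z ∈ Box,
      Real.exp (-(β * ((N : ℝ) - (ρ (plaquetteHolonomyZd (padConfig E' u) z 0 1)).trace.re))) :=
    (hFc.comp hpad).mul hg1
  -- a large torus on which `E'` embeds
  obtain ⟨L, hinj, hL⟩ := ((eventually_injOn_torusEdge (d := 2) E').and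
    (Filter.eventually_ge_atTop (4 * M + 3))).exists
  have hL2 : 2 ≤ L + 1 := by omega
  have hRn : 2 * M + 1 ≤ L + 1 := by omega
  -- transport both integrals to the torus `(ℤ/(L+1))²`
  have hnum : ∫ u, F (padConfig E' u) * ∏ z ∈ Box,
        Real.exp (-(β * ((N : ℝ) - (ρ (plaquetteHolonomyZd (padConfig E' u) z 0 1)).trace.re)))
        ∂(Measure.pi fun _ : ↥E' => haarProbability G) =
      ∫ U, toTorusObservable (L + 1) F U * ∏ p ∈ (range (2 * M + 1) ×ˢ range (2 * M + 1)).image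
          (fun q : ℕ × ℕ => (![((-(M : ℤ) : ℤ) : ZMod (L + 1)) + q.1, ((-(M : ℤ) : ℤ) : ZMod (L + 1)) + q.2] :
            Site 2 (L + 1))), Real.exp (-(β * ((N : ℝ) - (ρ (plaquetteHolonomy U p 0 1)).trace.re)))
        ∂(Measure.pi fun _ : Edge 2 (L + 1) => haarProbability G) := by
    rw [← integral_comp_torusEdge_eq hinj hgF]
    refine integral_congr_ae (ae_of_all _ fun U => ?_)
    exact (toTorusObservable_mul_prod_box_eq hFS hSE hE
      (fun g : G => Real.exp (-(β * ((N : ℝ) - (ρ g).trace.re)))) (n := L + 1) hRn hRn U).symm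
  have hden : ∫ u, ∏ z ∈ Box,
        Real.exp (-(β * ((N : ℝ) - (ρ (plaquetteHolonomyZd (padConfig E' u) z 0 1)).trace.re)))
        ∂(Measure.pi fun _ : ↥E' => haarProbability G) =
      ∫ U, ∏ p ∈ (range (2 * M + 1) ×ˢ range (2 * M + 1)).image
          (fun q : ℕ × ℕ => (![((-(M : ℤ) : ℤ) : ZMod (L + 1)) + q.1, ((-(M : ℤ) : ℤ) : ZMod (L + 1)) + q.2] :
            Site 2 (L + 1))), Real.exp (-(β * ((N : ℝ) - (ρ (plaquetteHolonomy U p 0 1)).trace.re)))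
        ∂(Measure.pi fun _ : Edge 2 (L + 1) => haarProbability G) := by
    rw [← integral_comp_torusEdge_eq hinj hg1]
    refine integral_congr_ae (ae_of_all _ fun U => ?_)
    have h1 := toTorusObservable_mul_prod_box_eq (F := fun _ : LGConfig 2 G => (1 : ℝ)) (S := S)
      (fun _ _ _ => rfl) hSE hE (fun g : G => Real.exp (-(β * ((N : ℝ) - (ρ g).trace.re))))
      (n := L + 1) hRn hRn U
    simp only [toTorusObservable_apply, one_mul] at h1
    exact h1.symm
  rw [hnum, hden]
  -- the torus integrands as products over the box sites of functions of single plaquettes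
  have hinjBox : ∀ z ∈ Box, ∀ z' ∈ Box, Literature.Probability.LatticeModels.Torus.proj (L + 1) z = Literature.Probability.LatticeModels.Torus.proj (L + 1) z' → z = z' := by
    intro z hz z' hz' h
    have h0 := hinj (Finset.mem_coe.2 (hE z hz).1) (Finset.mem_coe.2 (hE z' hz').1)
      (show torusEdge (L + 1) ((z, 0) : (Literature.MathematicalPhysics.QuantumLattice.ZdEdge 2)) = torusEdge (L + 1) ((z', 0) : (Literature.MathematicalPhysics.QuantumLattice.ZdEdge 2)) from Prod.ext h rfl)
    exact congrArg Prod.fst h0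
  have hReg : (range (2 * M + 1) ×ˢ range (2 * M + 1)).image
      (fun q : ℕ × ℕ => (![((-(M : ℤ) : ℤ) : ZMod (L + 1)) + q.1, ((-(M : ℤ) : ℤ) : ZMod (L + 1)) + q.2] :
        Site 2 (L + 1))) = Box.image (Literature.Probability.LatticeModels.Torus.proj (L + 1)) := (image_proj_box (L + 1) _ _ _ _).symm
  -- the puncture: the site right of the box
  set x₀ : Site 2 (L + 1) := ![((-(M : ℤ) : ℤ) : ZMod (L + 1)) + ((2 * M + 1 : ℕ) : ZMod (L + 1)),
    ((-(M : ℤ) : ℤ) : ZMod (L + 1))] with hx₀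
  have hx₀Box : ∀ z ∈ Box, Literature.Probability.LatticeModels.Torus.proj (L + 1) z ≠ x₀ := by
    intro z hz h
    obtain ⟨q, hq, rfl⟩ := Finset.mem_image.1 hz
    rw [proj_box] at h
    have h0 := congr_fun h 0
    simp only [hx₀, Matrix.cons_val_zero, add_right_inj] at h0
    have hq1 : q.1 < 2 * M + 1 := Finset.mem_range.1 (Finset.mem_product.1 hq).1
    have h1 := (ZMod.natCast_eq_natCast_iff' q.1 (2 * M + 1) (L + 1)).1 h0
    rw [Nat.mod_eq_of_lt (by omega), Nat.mod_eq_of_lt (by omega)] at h1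
    omega
  -- the weights per box site
  set K : (Literature.Probability.LatticeModels.Site 2) → G → ℝ := fun z g =>
    (if z ∈ Z then f z g else 1) * Real.exp (-(β * ((N : ℝ) - (ρ g).trace.re))) with hK
  have hKc : ∀ z, Continuous (K z) := fun z => by
    by_cases hz : z ∈ Z
    · simp only [hK, hz, if_true]; exact (hf z).mul hw
    · simp only [hK, hz, if_false, one_mul]; exact hw
  have hF_torus : ∀ U : GaugeConfig 2 (L + 1) G,
      toTorusObservable (L + 1) F U * ∏ p ∈ Box.image (Literature.Probability.LatticeModels.Torus.proj (L + 1)),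
          Real.exp (-(β * ((N : ℝ) - (ρ (plaquetteHolonomy U p 0 1)).trace.re))) =
        ∏ z ∈ Box, K z (plaquetteHolonomy U (Literature.Probability.LatticeModels.Torus.proj (L + 1) z) 0 1) := by
    intro U
    rw [Finset.prod_image hinjBox, toTorusObservable_apply, hF_def]
    have e1 : ∏ z ∈ Z, f z (plaquetteHolonomyZd (torusLift (L + 1) U) z 0 1) =
        ∏ z ∈ Box, (if z ∈ Z then f z (plaquetteHolonomy U (Literature.Probability.LatticeModels.Torus.proj (L + 1) z) 0 1) else 1) := by
      rw [← Finset.prod_subset hZBox (f := fun z =>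
        if z ∈ Z then f z (plaquetteHolonomy U (Literature.Probability.LatticeModels.Torus.proj (L + 1) z) 0 1) else 1) (fun z _ hz => if_neg hz)]
      exact Finset.prod_congr rfl fun z hz => by rw [if_pos hz, plaquetteHolonomy_proj]
    simp only []
    rw [e1, ← Finset.prod_mul_distrib]
  have h1_torus : ∀ U : GaugeConfig 2 (L + 1) G,
      ∏ p ∈ Box.image (Literature.Probability.LatticeModels.Torus.proj (L + 1)), Real.exp (-(β * ((N : ℝ) - (ρ (plaquetteHolonomy U p 0 1)).trace.re))) =
        ∏ z ∈ Box, (fun (_ : (Literature.Probability.LatticeModels.Site 2)) (g : G) => Real.exp (-(β * ((N : ℝ) - (ρ g).trace.re)))) z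
          (plaquetteHolonomy U (Literature.Probability.LatticeModels.Torus.proj (L + 1) z) 0 1) := fun U => by
    rw [Finset.prod_image hinjBox]
  simp_rw [hReg, hF_torus, h1_torus]
  rw [integral_prod_plaquette_comp_eq hL2 x₀ Box (Literature.Probability.LatticeModels.Torus.proj (L + 1)) (fun z hz z' hz' h => hinjBox z hz z' hz' h)
      hx₀Box K hKc,
    integral_prod_plaquette_comp_eq hL2 x₀ Box (Literature.Probability.LatticeModels.Torus.proj (L + 1)) (fun z hz z' hz' h => hinjBox z hz z' hz' h)
      hx₀Box _ fun _ => hw]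
  -- algebra: split the box product over `Z` and its complement
  have hKint : ∀ z, ∫ g, K z g ∂(haarProbability G) =
      if z ∈ Z then ∫ g, f z g * Real.exp (-(β * ((N : ℝ) - (ρ g).trace.re))) ∂(haarProbability G)
      else ∫ g, Real.exp (-(β * ((N : ℝ) - (ρ g).trace.re))) ∂(haarProbability G) := fun z => by
    by_cases hz : z ∈ Z
    · simp only [hK, hz, if_true]
    · simp only [hK, hz, if_false, one_mul]
  simp_rw [hKint]
  rw [← Finset.prod_sdiff hZBox, ← Finset.prod_sdiff hZBox (f := fun _ =>
      ∫ g, Real.exp (-(β * ((N : ℝ) - (ρ g).trace.re))) ∂(haarProbability G)),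
    Finset.prod_congr rfl (fun z hz => if_neg (Finset.mem_sdiff.1 hz).2),
    Finset.prod_congr rfl (fun z hz => if_pos hz), Finset.prod_const, Finset.prod_const, Finset.prod_div_distrib,
    Finset.prod_const]
  have hmk : (∫ g, Real.exp (-(β * ((N : ℝ) - (ρ g).trace.re))) ∂(haarProbability G)) ^ (Box \ Z).card ≠ 0 :=
    pow_ne_zero _ hm_pos.ne'
  field_simp

/-- **THE ONE-PLAQUETTE LAW OF THE INFINITE-VOLUME STATE IS THE TILTED HAAR LAW**: for every site `z` of `ℤ²` and
continuous `f`, `⟨f(U_z)⟩_μ = ∫ f w dHaar / ∫ w dHaar` (every infinite-volume limit point, every `β`). -/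
theorem integral_plaquetteObs_eq_of_mem_two (hρ : Continuous ρ) {β : ℝ} {μ : Measure (LGConfig 2 G)}
    (hμ : μ ∈ infiniteVolumeLimitPoints ρ β) (z : (Literature.Probability.LatticeModels.Site 2)) {f : G → ℝ} (hf : Continuous f) :
    ∫ V, f (plaquetteHolonomyZd V z 0 1) ∂μ =
      (∫ g, f g * Real.exp (-(β * ((N : ℝ) - (ρ g).trace.re))) ∂(haarProbability G)) /
        ∫ g, Real.exp (-(β * ((N : ℝ) - (ρ g).trace.re))) ∂(haarProbability G) := by
  have h := integral_prod_plaquetteObs_eq_of_mem_two ρ hρ hμ {z} (fun _ => f) fun _ => hf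
  simpa only [Finset.prod_singleton] using h

/-- **ZERO CORRELATION LENGTH**: for distinct sites `z ≠ z'` of `ℤ²` and continuous `f, g`,
`⟨f(U_z) g(U_{z'})⟩_μ = ⟨f(U_z)⟩_μ ⟨g(U_{z'})⟩_μ` — all connected two-point (indeed `n`-point) functions of plaquette
observables of the infinite-volume two-dimensional lattice gauge theory vanish identically. -/
theorem integral_mul_plaquetteObs_eq_of_mem_two (hρ : Continuous ρ) {β : ℝ} {μ : Measure (LGConfig 2 G)}
    (hμ : μ ∈ infiniteVolumeLimitPoints ρ β) {z z' : (Literature.Probability.LatticeModels.Site 2)} (hzz' : z ≠ z') {f g : G → ℝ} (hf : Continuous f)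
    (hg : Continuous g) :
    ∫ V, f (plaquetteHolonomyZd V z 0 1) * g (plaquetteHolonomyZd V z' 0 1) ∂μ =
      (∫ V, f (plaquetteHolonomyZd V z 0 1) ∂μ) * ∫ V, g (plaquetteHolonomyZd V z' 0 1) ∂μ := by
  classical
  have h := integral_prod_plaquetteObs_eq_of_mem_two ρ hρ hμ {z, z'} (fun y => if y = z then f else g)
    (fun y => by by_cases hy : y = z <;> simp [hy, hf, hg])
  simp only [Finset.prod_pair hzz', if_true, if_neg hzz'.symm] at h
  rw [h, integral_plaquetteObs_eq_of_mem_two ρ hρ hμ z hf, integral_plaquetteObs_eq_of_mem_two ρ hρ hμ z' hg]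

end InfiniteVolume

end Summit.Ventures.LatticeQCDFlow.Scoring
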